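import Summits.QuantumAdvantage.AdviceFreeQNC0.WalkTubeRankK
import Summits.QuantumAdvantage.AdviceFreeQNC0.WalkTubeRank
import Summits.QuantumAdvantage.AdviceFreeQNC0.WalkTubeMass
import Summits.QuantumAdvantage.AdviceFreeQNC0.BinomialTailLower
import Summits.QuantumAdvantage.AdviceFreeQNC0.OddPrimeWitnesses
import Literature.Computability.MetaComplexity.SmolenskyCharacter
import Mathlib.FieldTheory.IsAlgClosed.AlgebraicClosure
import HarnessLib

/-!
# Cell qa-qnc0 (odd primes, rung F-Q2-0): ≤2-SHOT strategies of polylog `𝔽_p`-degree lose the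
# u-walk game on a constant fraction of inputs, for EVERY prime `p ≠ 3` (sharp in `p`)

Planner qa-qnc0-p2's crux for odd primes is `WalkHardF p` (ROUND-12 §B.5, `OddPrimeStatements.lean`).
Prover memo HOME/qa-qnc0-prover/PROVER-MEMO-gen10.md §3 (R1) isolates the part α's TUBE METHOD settles
over `K = 𝔽_p(ω)`: strategies firing at most TWO cuts on every input (`#{g : y_g(u) = 1} ≤ 2`; positions
arbitrary, fully adaptive — every `2/3`-strategy the cell has found is of this kind); statement
`TwoShotHardF p` adopted by qn-p2 g13 (ROUND-13 §6).
* `TwoShot.three_mul_count`: in `K`, `3·T(u) = 2S(u) − R(u)` (`T` on-support shots, `S = Σ_g y_g` of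
  degree `d`, `R = Σ_g y_g(ψ_g + ψ_g²)`, `ψ_g = ω^{c+g+e_g(u)}` the path characters `chiK`); a two-shot
  strategy wins iff `T = 1`, and then `(2S − 3)·R = 1`, so every `Q` vanishing on the fail set
  satisfies `Q = Q·(2S − 3)·R` (`TwoShot.eq_mul_of_vanish`) and has no frequencies in
  `farSet n (D' + 2d)` (`TwoShot.LfunK_eq_zero_of_vanish`);
* `TwoShot.tubeBoundK` (rank form over `K` + Nie–Wang) and the assembly with the tree's `tubeMass` /
  `binomTailLower` as in `WalkTubeRank.tubePlan`: **`twoShotHardF : p ≠ 3 → TwoShotHardF p`**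
  (`K` = algebraic closure of `𝔽_p`, `ω` a root of `X² + X + 1`);
* `not_twoShotHardF_three` — sharpness: at `p = 3` the ONE-shot strategy of `walkEasyThree` wins.
WHAT THIS IS NOT: nothing for three or more shots (memo §3: quadratic identities in `T` bring window
characters); `WalkHardF p` (`p ≥ 5`) stays OPEN; separation NOT moved.
-/

noncomputable section

namespace Summit.QuantumAdvantage.AdviceFreeQNC0

open Classical
open Finset Polynomial
open Literature.Computability.MetaComplexity Literature.Computability.MetaComplexity.Smolensky
open CharK

/-- **`TwoShotHardF p`** — the u-walk game is hard for `𝔽_p`-degree-polylog players that fire at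
most two cuts on every input (shape of `WalkHardF p` plus `∀ u, #{g : y_g(u) = 1} ≤ 2`). -/
def TwoShotHardF (p : ℕ) [Fact p.Prime] : Prop :=
  ∃ θ : ℝ, θ < 1 ∧ ∀ C : ℕ, ∃ n₀ : ℕ, ∀ n ≥ n₀, ∀ c : ℕ, ∀ y : Fin (n + 1) → (Fin n → Bool) → Bool,
    (∀ g, HasDegF p (y g) ((Nat.log 2 n) ^ C)) →
    (∀ u, (univ.filter fun g : Fin (n + 1) => y g u = true).card ≤ 2) →
      ((univ.filter fun u : Fin n → Bool => ringWinU c y u = true).card : ℝ) ≤ θ * (2 : ℝ) ^ n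

namespace TwoShot

variable {K : Type*} [Field K] {ω : K} {n : ℕ}

/-! ### The strategy over `K` -/
/-- The `K`-valued indicator of the `g`-th output. -/
def yK (K : Type*) [Field K] (y : Fin (n + 1) → (Fin n → Bool) → Bool) (g : Fin (n + 1)) :
    CubeFn K n :=
  fun u => ιK K (y g u)

/-- `S = Σ_g y_g` (number of shots, in `K`). -/
def shotSum (K : Type*) [Field K] (y : Fin (n + 1) → (Fin n → Bool) → Bool) : CubeFn K n :=
  ∑ g : Fin (n + 1), yK K y g

/-- `R = Σ_g y_g (ψ_g + ψ_g²)`, `ψ_g(u) = ω^{c + g + e_g(u)}`. -/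
def charSum (ω : K) (c : ℕ) (y : Fin (n + 1) → (Fin n → Bool) → Bool) : CubeFn K n :=
  fun u => ∑ g : Fin (n + 1), yK K y g u *
    (ω ^ (c + g.val + walkExp u g.val) + (ω ^ (c + g.val + walkExp u g.val)) ^ 2)

/-- The number of on-support shots `T(u) = #{g : y_g(u) ∧ c + g + e_g(u) ≢ 0 (3)}`. -/
def count (c : ℕ) (y : Fin (n + 1) → (Fin n → Bool) → Bool) (u : Fin n → Bool) : ℕ :=
  (univ.filter fun g : Fin (n + 1) => y g u = true ∧ (c + g.val + walkExp u g.val) % 3 ≠ 0).card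

/-- `ringWinU` is the parity of `count`. -/
theorem ringWinU_eq (c : ℕ) (y : Fin (n + 1) → (Fin n → Bool) → Bool) (u : Fin n → Bool) :
    ringWinU c y u = decide (count c y u % 2 = 1) := rfl
/-- `S(u)` is the number of shots. -/
theorem shotSum_apply (y : Fin (n + 1) → (Fin n → Bool) → Bool) (u : Fin n → Bool) :
    shotSum K y u = ((univ.filter fun g : Fin (n + 1) => y g u = true).card : K) := by
  unfold shotSum yK ιK
  rw [Finset.sum_apply, Finset.card_filter]
  push_cast
  rfl

/-- In `K`: `2 − ω^e − ω^{2e} = 3·[e ≢ 0 (mod 3)]`. -/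
theorem two_sub_pow (hω : ω ^ 2 + ω + 1 = 0) (e : ℕ) :
    (2 : K) - ω ^ e - (ω ^ e) ^ 2 = if e % 3 ≠ 0 then 3 else 0 := by
  rw [← pow_mul, omega_pow_mod hω e, omega_pow_mod hω (e * 2)]
  have h3 : e % 3 < 3 := Nat.mod_lt _ (by norm_num)
  have hcases : e % 3 = 0 ∨ e % 3 = 1 ∨ e % 3 = 2 := by omega
  rcases hcases with h | h | h
  · rw [h, show e * 2 % 3 = 0 by omega, if_neg (by simp)]
    ring
  · rw [h, show e * 2 % 3 = 2 by omega, if_pos (by norm_num)]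
    linear_combination -hω
  · rw [h, show e * 2 % 3 = 1 by omega, if_pos (by norm_num)]
    linear_combination -hω

/-- **The count identity**: `3·T(u) = 2·S(u) − R(u)` in `K`. -/
theorem three_mul_count (hω : ω ^ 2 + ω + 1 = 0) (c : ℕ)
    (y : Fin (n + 1) → (Fin n → Bool) → Bool) (u : Fin n → Bool) :
    (3 : K) * count c y u = 2 * shotSum K y u - charSum ω c y u := by
  unfold count charSum shotSum yK ιK
  rw [Finset.sum_apply, Finset.mul_sum, ← Finset.sum_sub_distrib, Finset.card_filter]
  push_cast
  rw [Finset.mul_sum]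
  refine Finset.sum_congr rfl fun g _ => ?_
  by_cases hy : y g u = true
  · simp only [hy, true_and, if_true]
    have key := two_sub_pow hω (c + g.val + walkExp u g.val)
    by_cases h : (c + g.val + walkExp u g.val) % 3 ≠ 0
    · rw [if_pos h] at key ⊢
      linear_combination (-1 : K) * key
    · rw [if_neg h] at key ⊢
      linear_combination (-1 : K) * key
  · simp [hy]

/-- A two-shot WIN has exactly one on-support shot. -/
theorem count_eq_one_of_win {c : ℕ} {y : Fin (n + 1) → (Fin n → Bool) → Bool} {u : Fin n → Bool}
    (h2 : (univ.filter fun g : Fin (n + 1) => y g u = true).card ≤ 2)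
    (hwin : ringWinU c y u = true) : count c y u = 1 := by
  rw [ringWinU_eq, decide_eq_true_eq] at hwin
  have hle : count c y u ≤ 2 := by
    unfold count
    refine le_trans (Finset.card_le_card fun g hg => ?_) h2
    rw [mem_filter] at hg ⊢
    exact ⟨hg.1, hg.2.1⟩
  unfold count at hle hwin ⊢
  omega

/-- On a two-shot WIN: `R(u) = 2S(u) − 3` and `(2S(u) − 3)·R(u) = 1`. -/
theorem charSum_mul_of_win (hω : ω ^ 2 + ω + 1 = 0) {c : ℕ}
    {y : Fin (n + 1) → (Fin n → Bool) → Bool} {u : Fin n → Bool}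
    (h2 : (univ.filter fun g : Fin (n + 1) => y g u = true).card ≤ 2)
    (hwin : ringWinU c y u = true) :
    (2 * shotSum K y u - 3) * charSum ω c y u = 1 := by
  have hT := count_eq_one_of_win h2 hwin
  have hid := three_mul_count (K := K) hω c y u
  rw [hT, Nat.cast_one, mul_one] at hid
  have hR : charSum ω c y u = 2 * shotSum K y u - 3 := by linear_combination hid
  -- the number of shots is 1 or 2
  have hS1 : 1 ≤ (univ.filter fun g : Fin (n + 1) => y g u = true).card := by
    have : count c y u ≤ (univ.filter fun g : Fin (n + 1) => y g u = true).card := by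
      unfold count
      refine Finset.card_le_card fun g hg => ?_
      rw [mem_filter] at hg ⊢
      exact ⟨hg.1, hg.2.1⟩
    omega
  rw [hR, shotSum_apply]
  have hcases : (univ.filter fun g : Fin (n + 1) => y g u = true).card = 1 ∨
      (univ.filter fun g : Fin (n + 1) => y g u = true).card = 2 := by omega
  rcases hcases with h | h
  · rw [h]; norm_num
  · rw [h]; norm_num

/-! ### Degrees -/
/-- The `K`-indicator of an output of `𝔽_p`-degree `d` has `K`-degree `d` (base change). -/
theorem yK_mem_lowDeg {p : ℕ} [Fact p.Prime] [CharP K p] {d : ℕ}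
    (y : Fin (n + 1) → (Fin n → Bool) → Bool) (g : Fin (n + 1)) (hy : HasDegF p (y g) d) :
    yK K y g ∈ lowDeg K n d := by
  have h := comp_mem_lowDeg (ZMod.castHom (dvd_refl p) K) hy
  have e : (fun b => ZMod.castHom (dvd_refl p) K (if y g b = true then (1 : ZMod p) else 0)) =
      yK K y g := by
    funext b
    unfold yK ιK
    by_cases hb : y g b = true
    · rw [if_pos hb, if_pos hb, map_one]
    · rw [if_neg hb, if_neg hb, map_zero]
  rw [← e]
  exact h

/-- A polynomial of degree `D''` times a character has spectrum within distance `D''`. -/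
theorem lowDeg_mul_chiK_mem (hω : ω ^ 2 + ω + 1 = 0) (h3 : (3 : K) ≠ 0) {D'' : ℕ} {f : CubeFn K n}
    (hf : f ∈ lowDeg K n D'') (b : Fin n → Bool) :
    (fun u => f u * chiK ω b u) ∈ chiSpanK ω fun a => pdist a b ≤ D'' := by
  rw [lowDeg_eq_span] at hf
  induction hf using Submodule.span_induction with
  | mem g hg =>
    obtain ⟨⟨T, hT⟩, rfl⟩ := hg
    exact chiSpanK_mono (fun a ha => le_trans ha hT) (mono_mul_chiK_mem hω h3 T b)
  | zero =>
    have e : (fun u : Fin n → Bool => (0 : CubeFn K n) u * chiK ω b u) = 0 := by funext u; simp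
    rw [e]; exact Submodule.zero_mem _
  | add g h _ _ hg hh =>
    have e : (fun u => (g + h) u * chiK ω b u) =
        (fun u => g u * chiK ω b u) + fun u => h u * chiK ω b u := by
      funext u; simp [add_mul]
    rw [e]; exact Submodule.add_mem _ hg hh
  | smul r g _ hg =>
    have e : (fun u => (r • g) u * chiK ω b u) = r • fun u => g u * chiK ω b u := by
      funext u; simp [smul_eq_mul, mul_assoc]
    rw [e]; exact Submodule.smul_mem _ _ hg

/-- `pdist a (conj b) = pdist (conj a) b`. -/
theorem pdist_conj_comm (a b : Fin n → Bool) : pdist a (conj b) = pdist (conj a) b := by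
  unfold pdist conj
  congr 1
  ext i
  simp only [mem_filter, mem_univ, true_and]
  cases a i <;> cases b i <;> simp

/-! ### A polynomial vanishing on the fail set has no far frequencies -/

/-- **`Q = Q·(2S−3)·R`** for every `Q` vanishing on the fail set of a two-shot strategy. -/
theorem eq_mul_of_vanish (hω : ω ^ 2 + ω + 1 = 0) {c : ℕ}
    {y : Fin (n + 1) → (Fin n → Bool) → Bool}
    (h2 : ∀ u, (univ.filter fun g : Fin (n + 1) => y g u = true).card ≤ 2) {Q : CubeFn K n}
    (hvan : ∀ u, ringWinU c y u ≠ true → Q u = 0) :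
    Q = fun u => Q u * (2 * shotSum K y u - 3) * charSum ω c y u := by
  funext u
  by_cases hwin : ringWinU c y u = true
  · rw [mul_assoc, charSum_mul_of_win hω (h2 u) hwin, mul_one]
  · rw [hvan u hwin, zero_mul, zero_mul]

/-- **No far frequencies**: for a two-shot strategy of `K`-degree `d` and `Q ∈ lowDeg K n D'`
vanishing on its fail set, `L_a(Q) = 0` at every pattern of `farSet n (D' + 2d)`. -/
theorem LfunK_eq_zero_of_vanish (hω : ω ^ 2 + ω + 1 = 0) (h3 : (3 : K) ≠ 0) {c d D' : ℕ}
    {y : Fin (n + 1) → (Fin n → Bool) → Bool} (hdeg : ∀ g, yK K y g ∈ lowDeg K n d)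
    (h2 : ∀ u, (univ.filter fun g : Fin (n + 1) => y g u = true).card ≤ 2) {Q : CubeFn K n}
    (hQ : Q ∈ lowDeg K n D') (hvan : ∀ u, ringWinU c y u ≠ true → Q u = 0)
    {a : Fin n → Bool} (ha : a ∈ farSet n (D' + 2 * d)) :
    LfunK ω a Q = 0 := by
  rw [farSet, mem_filter] at ha
  obtain ⟨-, hfar, hfarc⟩ := ha
  -- the structured expansion of `Q`
  set P : (Fin n → Bool) → Prop := fun b => NearPath (D' + 2 * d) b ∨ NearPath (D' + 2 * d) (conj b)
    with hP
  have hmem : Q ∈ chiSpanK ω P := by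
    rw [eq_mul_of_vanish hω h2 hvan]
    -- `Q·(2S−3)` has degree `≤ D' + d`
    have hS : shotSum K y ∈ lowDeg K n d := Submodule.sum_mem _ fun g _ => hdeg g
    have hM : (fun u => Q u * (2 * shotSum K y u - 3)) ∈ lowDeg K n (D' + d) := by
      have e : (fun u => Q u * (2 * shotSum K y u - 3)) =
          Q * ((2 : K) • shotSum K y - (3 : K) • (1 : CubeFn K n)) := by
        funext u
        rw [Pi.mul_apply, Pi.sub_apply, Pi.smul_apply, Pi.smul_apply, Pi.one_apply, smul_eq_mul,
          smul_eq_mul, mul_one]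
      rw [e]
      exact mul_mem_lowDeg_add hQ (Submodule.sub_mem _ (Submodule.smul_mem _ _ hS)
        (Submodule.smul_mem _ _ (one_mem_lowDeg d)))
    -- expand `R`
    have e : (fun u => Q u * (2 * shotSum K y u - 3) * charSum ω c y u) =
        ∑ g : Fin (n + 1), ((fun u => (Q u * (2 * shotSum K y u - 3)) * yK K y g u * ω ^ (c + g.val) *
            chiK ω (aPat g.val) u) +
          fun u => (Q u * (2 * shotSum K y u - 3)) * yK K y g u * ω ^ (2 * (c + g.val)) *
            chiK ω (conj (aPat g.val)) u) := by
      funext u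
      rw [Finset.sum_apply]
      unfold charSum
      rw [Finset.mul_sum]
      refine Finset.sum_congr rfl fun g _ => ?_
      rw [Pi.add_apply, ← chiK_sq hω, pow_add, omega_pow_walkExp_K, mul_pow, ← pow_mul,
        mul_comm 2 (c + g.val)]
      ring
    rw [e]
    refine Submodule.sum_mem _ fun g _ => Submodule.add_mem _ ?_ ?_
    · -- path character term
      have hm : (fun u => Q u * (2 * shotSum K y u - 3) * yK K y g u * ω ^ (c + g.val)) ∈
          lowDeg K n (D' + 2 * d) := by
        have e1 : (fun u => Q u * (2 * shotSum K y u - 3) * yK K y g u * ω ^ (c + g.val)) =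
            ω ^ (c + g.val) • ((fun u => Q u * (2 * shotSum K y u - 3)) * yK K y g) := by
          funext u; simp only [Pi.smul_apply, Pi.mul_apply, smul_eq_mul]; ring
        rw [e1, show D' + 2 * d = D' + d + d by ring]
        exact Submodule.smul_mem _ _ (mul_mem_lowDeg_add hM (hdeg g))
      refine chiSpanK_mono (fun b hb => Or.inl ⟨g.val, hb⟩) (lowDeg_mul_chiK_mem hω h3 hm (aPat g.val))
    · -- conjugate path character term
      have hm : (fun u => Q u * (2 * shotSum K y u - 3) * yK K y g u * ω ^ (2 * (c + g.val))) ∈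
          lowDeg K n (D' + 2 * d) := by
        have e1 : (fun u => Q u * (2 * shotSum K y u - 3) * yK K y g u * ω ^ (2 * (c + g.val))) =
            ω ^ (2 * (c + g.val)) • ((fun u => Q u * (2 * shotSum K y u - 3)) * yK K y g) := by
          funext u; simp only [Pi.smul_apply, Pi.mul_apply, smul_eq_mul]; ring
        rw [e1, show D' + 2 * d = D' + d + d by ring]
        exact Submodule.smul_mem _ _ (mul_mem_lowDeg_add hM (hdeg g))
      refine chiSpanK_mono (fun b hb => Or.inr ⟨g.val, ?_⟩)
        (lowDeg_mul_chiK_mem hω h3 hm (conj (aPat g.val)))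
      rw [← pdist_conj_comm]; exact hb
  refine LfunK_eq_zero_of_mem ω ?_ hmem
  rintro (h | h)
  · exact hfar h
  · exact hfarc h

/-- **The tube bound for two-shot strategies**: `|farSet n (D'+2d)|·N_{D'}(n) ≤ 2^n·#FAIL`. -/
theorem tubeBoundK (hω : ω ^ 2 + ω + 1 = 0) (h3 : (3 : K) ≠ 0) {c d D' : ℕ}
    {y : Fin (n + 1) → (Fin n → Bool) → Bool} (hdeg : ∀ g, yK K y g ∈ lowDeg K n d)
    (h2 : ∀ u, (univ.filter fun g : Fin (n + 1) => y g u = true).card ≤ 2) :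
    (farSet n (D' + 2 * d)).card * numMonomials n D' ≤
      2 ^ n * (univ.filter fun u : Fin n → Bool => ¬ ringWinU c y u = true).card := by
  refine card_mul_numMonomials_le_of_vanish hω h3 _ _ D' fun Q hQ hQE a ha => ?_
  refine LfunK_eq_zero_of_vanish (c := c) hω h3 hdeg h2 hQ (fun u hu => hQE u ?_) ha
  exact mem_filter.2 ⟨mem_univ _, hu⟩

/-! ### The field `K = 𝔽̄_p` and the assembly -/

/-- For a prime `p ≠ 3` there is a field of characteristic `p` with `ω² + ω + 1 = 0` and `3 ≠ 0`
(the algebraic closure of `𝔽_p` and a root of `X² + X + 1`). -/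
theorem exists_omega (p : ℕ) [Fact p.Prime] (hp3 : p ≠ 3) :
    ∃ ω : AlgebraicClosure (ZMod p), ω ^ 2 + ω + 1 = 0 ∧ (3 : AlgebraicClosure (ZMod p)) ≠ 0 := by
  set L := AlgebraicClosure (ZMod p)
  have hdeg : (X ^ 2 + X + 1 : L[X]).degree ≠ 0 := by
    have h : (X ^ 2 + X + 1 : L[X]).degree = 2 := by
      compute_degree!
    rw [h]; norm_num
  obtain ⟨ω, hω⟩ := IsAlgClosed.exists_root (X ^ 2 + X + 1 : L[X]) hdeg
  refine ⟨ω, ?_, ?_⟩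
  · simpa [IsRoot, eval_add, eval_pow, eval_X, eval_one] using hω
  · intro h
    have h' : ((3 : ℕ) : L) = 0 := by exact_mod_cast h
    rw [CharP.cast_eq_zero_iff L p 3] at h'
    exact hp3 ((Nat.prime_dvd_prime_iff_eq (Fact.out : p.Prime) Nat.prime_three).1 h')

/-- `#WIN + #FAIL = 2^n`. -/
theorem card_win_add_card_fail (c : ℕ) (y : Fin (n + 1) → (Fin n → Bool) → Bool) :
    (univ.filter fun u : Fin n → Bool => ringWinU c y u = true).card +
      (univ.filter fun u : Fin n → Bool => ¬ ringWinU c y u = true).card = 2 ^ n := by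
  rw [card_filter_add_card_filter_not, card_univ, Fintype.card_fun, Fintype.card_bool,
    Fintype.card_fin]

end TwoShot

open TwoShot TubePlanProof in
/-- **`TwoShotHardF p` — PROVED for every prime `p ≠ 3`** (tube method over `K = 𝔽̄_p ∋ ω`;
`θ = 1 − c/2` with `c` from `binomTailLower (C₁+1)`, `C₁` from `tubeMass`; `D' = n/2 − C₁⌊√n⌋ − 2d`). -/
theorem twoShotHardF (p : ℕ) [Fact p.Prime] (hp3 : p ≠ 3) : TwoShotHardF p := by
  obtain ⟨ω, hω, h3⟩ := exists_omega p hp3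
  obtain ⟨C₁, m₀, hmass⟩ := tubeMass
  obtain ⟨c, hc, m₁, htail⟩ := binomTailLower (C₁ + 1)
  refine ⟨1 - c / 2, by linarith, fun C => ?_⟩
  obtain ⟨n₂, hn₂⟩ := logPow_le_natSqrt (C + 1)
  refine ⟨max (max m₀ m₁) (max n₂ (4 * (C₁ + 1) ^ 2 + 4)), fun n hn ch y hy h2 => ?_⟩
  have hm₀ : m₀ ≤ n := le_trans (le_trans (le_max_left _ _) (le_max_left _ _)) hn
  have hm₁ : m₁ ≤ n := le_trans (le_trans (le_max_right _ _) (le_max_left _ _)) hn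
  have hn₂' : n₂ ≤ n := le_trans (le_trans (le_max_left _ _) (le_max_right _ _)) hn
  have hbig : 4 * (C₁ + 1) ^ 2 + 4 ≤ n := le_trans (le_trans (le_max_right _ _) (le_max_right _ _)) hn
  set d := (Nat.log 2 n) ^ C with hd
  set s := Nat.sqrt n with hs
  have hlog2 : 2 ≤ Nat.log 2 n := Nat.le_log_of_pow_le (by norm_num) (by omega)
  have hDs : 2 * d ≤ s := by
    have h1 : (Nat.log 2 n) ^ (C + 1) ≤ s := hn₂ n hn₂'
    have h2 : 2 * d ≤ (Nat.log 2 n) ^ (C + 1) := by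
      rw [hd, pow_succ, mul_comm]
      exact Nat.mul_le_mul_left _ hlog2
    omega
  have hs2 : 2 * (C₁ + 1) ≤ s := by
    rw [hs, Nat.le_sqrt]
    nlinarith
  have hss : s * s ≤ n := Nat.sqrt_le n
  have hfit2 : 2 * (2 * d + C₁ * s) ≤ n := by nlinarith
  have hfit : 2 * d + C₁ * s ≤ n / 2 := by omega
  set D' := n / 2 - C₁ * s - 2 * d with hD'
  have hsum : D' + 2 * d = n / 2 - C₁ * s := by omega
  have ht : n / 2 - (C₁ * s + 2 * d) = D' := by omega
  have htle : C₁ * s + 2 * d ≤ (C₁ + 1) * s := by nlinarith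
  have hdeg : ∀ g, yK (AlgebraicClosure (ZMod p)) y g ∈ lowDeg (AlgebraicClosure (ZMod p)) n d :=
    fun g => yK_mem_lowDeg y g (hy g)
  have h₃ := tubeBoundK (c := ch) (D' := D') hω h3 hdeg h2
  rw [hsum] at h₃
  have h₄ := hmass n hm₀
  have h₅ := htail n hm₁ (C₁ * s + 2 * d) htle
  rw [ht] at h₅
  set FAR := (farSet n (n / 2 - C₁ * s)).card with hFAR
  set N := numMonomials n D' with hN
  set FAIL := (univ.filter fun u : Fin n → Bool => ¬ ringWinU ch y u = true).card with hFAIL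
  have h2n : (0 : ℝ) < (2 : ℝ) ^ n := by positivity
  have h₃R : (FAR : ℝ) * N ≤ (2 : ℝ) ^ n * FAIL := by exact_mod_cast h₃
  have h₄R : (2 : ℝ) ^ n ≤ 2 * FAR := by exact_mod_cast h₄
  have hfail : c / 2 * (2 : ℝ) ^ n ≤ FAIL := by
    have step1 : (2 : ℝ) ^ n / 2 * (c * (2 : ℝ) ^ n) ≤ (FAR : ℝ) * N :=
      mul_le_mul (by linarith) h₅ (by positivity) (Nat.cast_nonneg _)
    have step2 : (2 : ℝ) ^ n * (c / 2 * (2 : ℝ) ^ n) ≤ (2 : ℝ) ^ n * FAIL := by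
      calc (2 : ℝ) ^ n * (c / 2 * (2 : ℝ) ^ n) = (2 : ℝ) ^ n / 2 * (c * (2 : ℝ) ^ n) := by ring
        _ ≤ (FAR : ℝ) * N := step1
        _ ≤ (2 : ℝ) ^ n * FAIL := h₃R
    exact le_of_mul_le_mul_left step2 h2n
  have hwin := card_win_add_card_fail ch y
  have hwinR : ((univ.filter fun u : Fin n → Bool => ringWinU ch y u = true).card : ℝ) + FAIL =
      (2 : ℝ) ^ n := by
    rw [hFAIL]; exact_mod_cast hwin
  linarith

/-- **Sharpness in `p`: `¬ TwoShotHardF 3`** — at `p = 3` the ONE-shot degree-`2` strategy of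
`walkEasyThree` wins the u-walk game on every input. -/
theorem not_twoShotHardF_three : ¬ TwoShotHardF 3 := by
  rintro ⟨θ, hθ, h⟩
  obtain ⟨n₀, hn₀⟩ := h 1
  set n := max n₀ 4 with hn
  obtain ⟨y, hdeg, hshots, hwin⟩ := walkEasyThree_oneShot 0 n (by omega)
  have hlog : 2 ≤ Nat.log 2 n := Nat.le_log_of_pow_le (by norm_num) (by omega)
  have hdeg' : ∀ g, HasDegF 3 (y g) ((Nat.log 2 n) ^ 1) := fun g =>
    lowDeg_mono (by rw [pow_one]; exact hlog) (hdeg g)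
  have hb := hn₀ n (le_max_left _ _) 0 y hdeg' (fun u => le_trans (hshots u) (by norm_num))
  have hall : (univ.filter fun u : Fin n → Bool => ringWinU 0 y u = true) = univ :=
    Finset.filter_true_of_mem fun u _ => hwin u
  rw [hall, card_univ, Fintype.card_fun, Fintype.card_bool, Fintype.card_fin] at hb
  push_cast at hb
  have hpos : (0 : ℝ) < (2 : ℝ) ^ n := by positivity
  nlinarith

end Summit.QuantumAdvantage.AdviceFreeQNC0

end
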